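import Literature.Analysis.FluidPDE.ClassicalSolutionGlue
import Literature.Analysis.FluidPDE.MildSolutionProofs
import Literature.Analysis.FluidPDE.RotatedDSSLimitStructure
import HarnessLib

/-!
# Classical solutions on the open past are ancient mild solutions

Analysis/FluidPDE support file (everything proved; no definitions, no named facts). A
route-independent home for the bridge «classical on `(−∞, 0)` + bounded on past slabs ⇒ ancient
mild» (Fabes–Jones–Rivière 1972, Thm. 2.1: bounded classical solutions are mild; applied on every
`[s, t] ⊂ (−∞, 0)` and translated back), which several routes of `Summits/NavierStokesRegularity`
need (it was first proved inside `Theorems/CorkscrewDynamoClassicalCorkscrewSuffices.lean` as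
`isAncientMildSolution_of_classical_Iio`, a route-specific module that other routes' files may not
import without tripping `lint.theses-cone`; `Theorems/AngularGalerkinLadderStructurePassesSpaceTime`
carries a private copy for the same reason):

* `IsClassicalNSSolutionOn.isAncientMildSolution_of_isBoundedOn` — `(u, p)` classical on the time
  set `(−∞, 0)`, `ν > 0`, no force, `u` and `p` bounded on every past slab `(−∞, t]`, `t < 0`
  ⟹ `IsAncientMildSolution ν u` (slices classically hence weakly divergence-free; on `[0, t − s]`
  the time-translate is a bounded classical solution, hence mild by the tree's discharged
  `IsClassicalNSSolutionOn.isMildNSSolutionOn_holds`; translate the two-time identity back);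
* `IsClassicalNSSolutionOn.isAncientMildSolution_of_hasTypeIDecay` — the same with the velocity
  bound supplied by a Type-I bound `‖u(t, x)‖ ≤ C₀/(‖x‖ + √−t)`
  (`HasTypeIDecay.isBoundedOn_Iic`): the form consumed by Type-I (r)DSS profile extractions
  (KNSS 2009 §6; the ladder-limit step of the angular Galerkin ladder).

WHAT THIS IS NOT: no statement about solutions that are merely bounded with unnormalised pressure
beyond the slab-boundedness hypothesis (parasitic solutions are excluded by the pressure bound).

## References

* E. B. Fabes, B. F. Jones, N. M. Rivière, *The initial value problem for the Navier–Stokes equations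
  with data in `Lᵖ`*, Arch. Rational Mech. Anal. 45 (1972) 222–240, §2, Thm. 2.1. [FabesJonesRiviere1972]
* G. Koch, N. Nadirashvili, G. Seregin, V. Šverák, *Liouville theorems for the Navier–Stokes
  equations and applications*, Acta Math. 203 (2009) = arXiv:0709.3599, §1 (1.3)–(1.6) (ancient
  mild solutions, Type-I bounds). [KochNadirashviliSereginSverak2009]
-/

noncomputable section

open MeasureTheory Set Function Filter
open _root_.Topology

namespace Literature.Analysis.FluidPDE

variable {E : Type*} [NormedAddCommGroup E] [InnerProductSpace ℝ E] [FiniteDimensional ℝ E]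
  [MeasurableSpace E] [BorelSpace E]

/-- **Classical solutions on the past are ancient mild solutions.** If `(u, p)` is a classical
Navier–Stokes solution (viscosity `ν > 0`, no force) on the time set `(−∞, 0)` with `u` and `p`
bounded on every past slab `(−∞, t]`, `t < 0`, then `u` is an ancient mild solution
(`IsAncientMildSolution ν u`): slices are classically hence weakly divergence free, and for
`s < t < 0` the time-translate by `s` is a bounded classical solution on `[0, t − s]`, hence mild
there (Fabes–Jones–Rivière 1972, Thm. 2.1; tree `IsClassicalNSSolutionOn.isMildNSSolutionOn_holds`);
translating the two-time identity back (`IsMildNSSolutionBetween.comp_add_right`) gives it between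
`s` and `t`. (Same proof as the route-local `Theorems.isAncientMildSolution_of_classical_Iio`.)
[cite: FabesJonesRiviere1972, §2 Thm. 2.1] -/
theorem IsClassicalNSSolutionOn.isAncientMildSolution_of_isBoundedOn
    {ν : ℝ} (hν : 0 < ν) {u : ℝ → E → E} {p : ℝ → E → ℝ}
    (hcl : IsClassicalNSSolutionOn (Iio 0) ν 0 u p)
    (hu : ∀ t < 0, IsBoundedOn (Iic t) u) (hp : ∀ t < 0, IsBoundedOn (Iic t) p) :
    IsAncientMildSolution ν u := by
  refine ⟨fun t ht => ?_, fun s t hst ht => ?_⟩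
  · exact VectorCalculus.IsDivFree.isWeaklyDivFree_holds (hcl.divFree t ht)
      (contDiff_infty.1 (hcl.contDiff_velocity ht) 1)
  · -- the time-translate by `s` is classical on `(· + s)⁻¹' (-∞, 0) ⊇ [0, t - s]`
    have hE : IsClassicalNSSolutionOn ((· + s) ⁻¹' Iio 0) ν (fun τ => (0 : ℝ → E → E) (τ + s))
        (fun τ => u (τ + s)) (fun τ => p (τ + s)) := hcl.comp_add_right s
    have hshift : ∀ {τ : ℝ}, τ ∈ Icc 0 (t - s) → τ + s ≤ t := fun hτ => by linarith [hτ.2]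
    have hIcc : Icc 0 (t - s) ⊆ (· + s) ⁻¹' Iio (0 : ℝ) := fun τ hτ => by
      show τ + s < 0
      linarith [hshift hτ]
    obtain ⟨Mu, hMu⟩ := hu t ht
    obtain ⟨Mp, hMp⟩ := hp t ht
    have hbu : IsBoundedOn (Icc 0 (t - s)) (fun τ => u (τ + s)) :=
      ⟨Mu, fun τ hτ x => hMu (τ + s) (hshift hτ) x⟩
    have hbp : IsBoundedOn (Icc 0 (t - s)) (fun τ => p (τ + s)) :=
      ⟨Mp, fun τ hτ x => hMp (τ + s) (hshift hτ) x⟩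
    have hbf : IsBoundedOn (Icc 0 (t - s)) (fun τ => (0 : ℝ → E → E) (τ + s)) :=
      ⟨0, fun τ _ x => by simp⟩
    -- Fabes–Jones–Rivière on `[0, t - s]`
    have hmild : IsMildNSSolutionOn (Icc 0 (t - s)) ν (fun τ => (0 : ℝ → E → E) (τ + s))
        ((fun τ => u (τ + s)) 0) (fun τ => u (τ + s)) :=
      IsClassicalNSSolutionOn.isMildNSSolutionOn_holds (T := t - s) hE hν hIcc hbu hbp hbf
    have key : IsMildNSSolutionBetween ν (fun τ => (0 : ℝ → E → E) (τ + s)) (fun τ => u (τ + s))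
        (s + -s) (t + -s) := by
      rw [add_neg_cancel, ← sub_eq_add_neg]
      exact isMildNSSolutionFrom_self_iff.1 (hmild.2 (t - s) ⟨by linarith, le_rfl⟩)
    -- translate back by `-s`
    have h3 := key.comp_add_right
    have hu_eq : (fun τ => u (τ + -s + s)) = u := funext fun τ => by rw [neg_add_cancel_right]
    have hf_eq : (fun τ => (0 : ℝ → E → E) (τ + -s + s)) = 0 := funext fun τ => by simp
    rwa [hu_eq, hf_eq] at h3

/-- **Type-I classical solutions on the past are ancient mild solutions**: `(u, p)` classical on
`(−∞, 0)` (viscosity `ν > 0`, no force) with the Type-I bound `‖u(t, x)‖ ≤ C₀/(‖x‖ + √−t)`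
(KNSS 2009, (1.6); it bounds `u` by `C₀/√(−t)` on every past slab `(−∞, t]`,
`HasTypeIDecay.isBoundedOn_Iic`) and pressure bounded on every past slab is an ancient mild solution.
The mildness clause of the ladder-limit / profile-extraction steps of Type-I (r)DSS arguments.
[cite: KochNadirashviliSereginSverak2009, §1 (1.3)–(1.6)] -/
theorem IsClassicalNSSolutionOn.isAncientMildSolution_of_hasTypeIDecay
    {ν : ℝ} (hν : 0 < ν) {u : ℝ → E → E} {p : ℝ → E → ℝ} {C₀ : ℝ}
    (hcl : IsClassicalNSSolutionOn (Iio 0) ν 0 u p) (hI : HasTypeIDecay C₀ u)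
    (hp : ∀ t < 0, IsBoundedOn (Iic t) p) : IsAncientMildSolution ν u :=
  hcl.isAncientMildSolution_of_isBoundedOn hν (fun _ ht => hI.isBoundedOn_Iic ht) hp

end Literature.Analysis.FluidPDE

end
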